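import Summits.ValiantsHypothesis.ValiantsHypothesis.Theorems.VPBoundarySquareTrdeg
import Mathlib.FieldTheory.PrimitiveElement
import HarnessLib

/-!
# VPBoundarySquare — FEW CONSTANTS: every `\overline{VP}` p-family has all its coefficients in a
subfield of `ℂ` generated over `ℚ` by polynomially many numbers

Sequel to `VPBoundarySquareTrdeg` (transcendence bound `trdeg_ℚ ℚ(coeff f_n) ≤ poly(n)` for
`f ∈ \overline{VP}`, NODE v9 of the decomposition workshop). Here the bound is turned into
GENERATORS: by extracting a maximal algebraically independent sub-family of the coefficients and ONE
primitive element of the finite extension they generate over it (`Field.exists_primitive_element`,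
characteristic `0`), all (exponentially many) coefficients of `f_n` lie in `ℚ(κ_{n,1}, …, κ_{n,m(n)})`
with `m` p-bounded (`isVPBarFamily_fewConstants`). This is the "polynomially many constants" half of
`CHClosureDefinable` (**U_CH**, item 24721) proved UNCONDITIONALLY — the recorded `2^{poly}`-parameter
obstruction (Laurent coefficients of an approximation) is not an obstruction to the NUMBER of
constants; what U_CH asks beyond this file is the exponential FORMAT and `CH/poly`-definability of an
integer skeleton `Q_n` with `f_n = Q_n(x, κ_n)` (clearing the finitely many denominators costs one
more constant). `fewConstants_of_chClosureDefinable` records that U_CH implies the same conclusion.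
0 sorry; no statement of record, split or `closes` changes.
-/

noncomputable section

set_option linter.dupNamespace false

open MvPolynomial
open Literature.Computability.AlgebraicComplexity

namespace Summit.ValiantsHypothesis.ValiantsHypothesis.Theorems.VPBoundarySquareFewConstants

open Summit.ValiantsHypothesis.ValiantsHypothesis.Theorems.VPBoundarySquareTrdeg

/-- Evaluating a polynomial with coefficients in an intermediate field `F ≤ K'` at a point of `K'`
stays in `K'`. [folklore] -/
theorem aeval_mem_of_le {F K' : IntermediateField ℚ ℂ} (hFK : F ≤ K') {α : ℂ} (hα : α ∈ K')
    (p : Polynomial F) : Polynomial.aeval α p ∈ K' := by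
  rw [Polynomial.aeval_eq_sum_range]
  refine sum_mem fun n _ => ?_
  rw [Algebra.smul_def]
  exact mul_mem (hFK (p.coeff n).2) (pow_mem hα n)

/-- **Few generators.** If no `m + 1` members of a finite family `x` of complex numbers are
algebraically independent over `ℚ`, then all members lie in a subfield of `ℂ` generated over `ℚ` by
`m + 1` elements (a maximal algebraically independent sub-family — at most `m` members — plus ONE
primitive element of the finite extension it leaves, `Field.exists_primitive_element`). [folklore] -/
theorem exists_generators {ι : Type} [Fintype ι] [DecidableEq ι] (x : ι → ℂ) (m : ℕ)
    (hdep : ∀ c : Fin (m + 1) → ι, ¬ AlgebraicIndependent ℚ fun j => x (c j)) :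
    ∃ κ : Fin (m + 1) → ℂ, ∀ i, x i ∈ IntermediateField.adjoin ℚ (Set.range κ) := by
  classical
  -- 1. an algebraically independent sub-family of maximal size
  let good : Finset (Finset ι) := Finset.univ.filter fun s => AlgebraicIndepOn ℚ x (↑s : Set ι)
  have hne : good.Nonempty := by
    refine ⟨∅, Finset.mem_filter.mpr ⟨Finset.mem_univ _, ?_⟩⟩
    rw [AlgebraicIndepOn, Finset.coe_empty]
    exact algebraicIndependent_empty_type_iff.mpr (algebraMap ℚ ℂ).injective
  obtain ⟨s, hs, hmax⟩ := Finset.exists_max_image good Finset.card hne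
  have hsind : AlgebraicIndepOn ℚ x (↑s : Set ι) := (Finset.mem_filter.mp hs).2
  -- 2. it has at most `m` members
  have hcard : s.card ≤ m := by
    by_contra hlt
    push Not at hlt
    obtain ⟨e⟩ : Nonempty (Fin (m + 1) ↪ (↑s : Set ι)) :=
      Function.Embedding.nonempty_of_card_le (by simp; omega)
    exact hdep (fun j => (e j : ι)) (hsind.comp e e.injective)
  -- 3. every member is algebraic over `A = ℚ[x_s]`
  have halg : ∀ i, IsAlgebraic (Algebra.adjoin ℚ (x '' (↑s : Set ι))) (x i) := by
    intro i
    by_cases hi : i ∈ s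
    · exact isAlgebraic_algebraMap
        (⟨x i, Algebra.subset_adjoin ⟨i, Finset.mem_coe.mpr hi, rfl⟩⟩ : Algebra.adjoin ℚ (x '' (↑s : Set ι)))
    · by_contra htr
      have hins : AlgebraicIndepOn ℚ x (insert i (↑s : Set ι)) :=
        (AlgebraicIndepOn.insert_iff (Finset.mem_coe.not.mpr hi)).mpr ⟨hsind, htr⟩
      have hmem : insert i s ∈ good := by
        refine Finset.mem_filter.mpr ⟨Finset.mem_univ _, ?_⟩
        rwa [Finset.coe_insert]
      have := hmax _ hmem
      rw [Finset.card_insert_of_notMem hi] at this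
      omega
  -- 4. hence integral over the field `F = ℚ(x_s)`
  let F : IntermediateField ℚ ℂ := IntermediateField.adjoin ℚ (x '' (↑s : Set ι))
  have hAF : ∀ a : ℂ, a ∈ Algebra.adjoin ℚ (x '' (↑s : Set ι)) → a ∈ F := fun a ha =>
    IntermediateField.algebra_adjoin_le_adjoin ℚ _ ha
  let φ : Algebra.adjoin ℚ (x '' (↑s : Set ι)) →+* F :=
    { toFun := fun a => ⟨(a : ℂ), hAF a a.2⟩
      map_one' := rfl
      map_mul' := fun _ _ => rfl
      map_zero' := rfl
      map_add' := fun _ _ => rfl }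
  have hφ : Function.Injective φ := fun a b h => Subtype.ext (congrArg Subtype.val h :)
  have hint : ∀ i, IsIntegral F (x i) := by
    intro i
    obtain ⟨p, hp0, hpx⟩ := halg i
    refine IsAlgebraic.isIntegral ⟨p.map φ, fun h => hp0 (Polynomial.map_injective φ hφ (by simpa using h)), ?_⟩
    rw [Polynomial.aeval_def, Polynomial.eval₂_map]
    rw [Polynomial.aeval_def] at hpx
    exact hpx
  -- 5. the finite extension `E = F(x_ι)` has a primitive element
  let E : IntermediateField F ℂ := IntermediateField.adjoin F (Set.range x)
  haveI : FiniteDimensional F E :=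
    IntermediateField.finiteDimensional_adjoin fun y ⟨i, hi⟩ => hi ▸ hint i
  obtain ⟨α, hα⟩ := Field.exists_primitive_element F E
  have hE : E = IntermediateField.adjoin F {(α : ℂ)} := by
    rw [← IntermediateField.lift_adjoin_simple (K := E) (α := α), hα, IntermediateField.lift_top (K := E)]
  -- 6. the generators: `x_s` (padded) and `α`
  let κ : Fin (m + 1) → ℂ := fun j =>
    if h : (j : ℕ) < s.card then x ((s.equivFin.symm ⟨j, h⟩ : (↑s : Set ι))) else (α : ℂ)
  have hακ : (α : ℂ) ∈ Set.range κ := ⟨⟨m, by omega⟩, by simp [κ, show ¬ (m < s.card) by omega]⟩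
  have hsκ : x '' (↑s : Set ι) ⊆ Set.range κ := by
    rintro _ ⟨i, hi, rfl⟩
    refine ⟨⟨(s.equivFin ⟨i, hi⟩ : ℕ), by have := (s.equivFin ⟨i, hi⟩).2; omega⟩, ?_⟩
    simp [κ, (s.equivFin ⟨i, hi⟩).2]
  refine ⟨κ, fun i => ?_⟩
  have hFK : F ≤ IntermediateField.adjoin ℚ (Set.range κ) := IntermediateField.adjoin.mono ℚ _ _ hsκ
  have hαK : (α : ℂ) ∈ IntermediateField.adjoin ℚ (Set.range κ) :=
    IntermediateField.subset_adjoin ℚ _ hακ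
  have hxE : x i ∈ E := IntermediateField.subset_adjoin F _ ⟨i, rfl⟩
  rw [hE, IntermediateField.mem_adjoin_simple_iff] at hxE
  obtain ⟨r, q, hrq⟩ := hxE
  rw [hrq]
  exact div_mem (aeval_mem_of_le hFK hαK r) (aeval_mem_of_le hFK hαK q)


/-- **FEW CONSTANTS for `\overline{VP}`.** For a p-family `f_n ∈ ℂ[x_1..x_{v(n)}]` of p-bounded
approximate complexity there is a p-bounded `m` and, for every `n`, numbers `κ_{n,1}, …, κ_{n,m(n)} ∈ ℂ`
such that EVERY coefficient of `f_n` lies in the subfield `ℚ(κ_n)`.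
[cite: BurgisserEtAl2011, §9.3 (closure of VP)] [cite: Burgisser2024Completeness, §4.2 (p0016 L42–L54)] -/
theorem isVPBarFamily_fewConstants {v : ℕ → ℕ} {f : ∀ n, MvPolynomial (Fin (v n)) ℂ}
    (hpf : IsPFamily f) (hf : IsVPBarFamily f) :
    ∃ m : ℕ → ℕ, IsPBounded m ∧ ∀ n, ∃ κ : Fin (m n) → ℂ,
      ∀ d, coeff d (f n) ∈ IntermediateField.adjoin ℚ (Set.range κ) := by
  classical
  obtain ⟨m, hm, hdep⟩ := isVPBarFamily_coeff_trdeg_le' hpf hf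
  refine ⟨fun n => m n + 1, IsPBounded.add_holds hm (IsPBounded.const 1), fun n => ?_⟩
  obtain ⟨κ, hκ⟩ := exists_generators (fun d : ↥((f n).support) => coeff (d : Fin (v n) →₀ ℕ) (f n))
    (m n) fun c => hdep n (m n + 1) (Nat.lt_succ_self _) fun j => ((c j) : Fin (v n) →₀ ℕ)
  refine ⟨κ, fun d => ?_⟩
  by_cases hd : d ∈ (f n).support
  · exact hκ ⟨d, hd⟩
  · rw [notMem_support_iff.mp hd]
    exact zero_mem _

open Summit.ValiantsHypothesis.ValiantsHypothesis.Theses.VPBoundarySquare in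
/-- **U_CH implies the same conclusion** (with `m = #κ_n + 1`): the few-constants theorem above is
the unconditional shadow of `CHClosureDefinable` (item 24721). [cite: Burgisser2026HNC, Def. 4.2 (p. 11)] -/
theorem fewConstants_of_chClosureDefinable (hU : CHClosureDefinable) {v : ℕ → ℕ}
    {f : ∀ n, MvPolynomial (Fin (v n)) ℂ} (hpf : IsPFamily f) (hf : IsVPBarFamily f) :
    ∃ m : ℕ → ℕ, IsPBounded m ∧ ∀ n, ∃ κ : Fin (m n) → ℂ,
      ∀ d, coeff d (f n) ∈ IntermediateField.adjoin ℚ (Set.range κ) := by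
  classical
  obtain ⟨m, hm, hdep⟩ := coeff_trdeg_le_of_chClosureDefinable hU hpf hf
  refine ⟨fun n => m n + 1, IsPBounded.add_holds hm (IsPBounded.const 1), fun n => ?_⟩
  obtain ⟨κ, hκ⟩ := exists_generators (fun d : ↥((f n).support) => coeff (d : Fin (v n) →₀ ℕ) (f n))
    (m n) fun c => hdep n (m n + 1) (Nat.lt_succ_self _) fun j => ((c j) : Fin (v n) →₀ ℕ)
  refine ⟨κ, fun d => ?_⟩
  by_cases hd : d ∈ (f n).support
  · exact hκ ⟨d, hd⟩
  · rw [notMem_support_iff.mp hd]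
    exact zero_mem _

end Summit.ValiantsHypothesis.ValiantsHypothesis.Theorems.VPBoundarySquareFewConstants

end
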